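import Literature.MathematicalPhysics.QuantumLattice.GaugeGroups
import Literature.RepresentationTheory.CompactGroups.UnitaryTrick
import HarnessLib

/-!
# Lüscher's admissibility-constrained plaquette weight

Finite-volume lattice gauge theory on the discrete torus `(ℤ/Lℤ)^d` (vocabulary of
`ConstructiveQFTWave0`: `GaugeConfig d L G`, `Plaquette`, `plaquetteHolonomy`, `gaugeTransform`,
`haarProbability`) with the **admissibility-constrained ("topology conserving") plaquette
action**: for a matrix representation `ρ : G →* M_N(ℂ)` of the compact gauge group (the
fundamental one when `G ⊆ U(N)`), inverse coupling `β` and cut `δ > 0`, the Boltzmann weight of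
a configuration `U` is
`admissiblePlaquetteWeight ρ β δ U = ∏ₚ w_{β,δ}(tₚ(U))`, with the plaquette defect
`tₚ(U) = Re tr(1 - ρ(U_p)) = N - Re tr ρ(U_p)` (`plaquetteDefect`; the Wilson action is `∑ₚ tₚ`,
`wilsonAction_eq_sum_plaquetteDefect`) and the single-plaquette cut-off factor
`w_{β,δ}(t) = exp(-β t / (1 - t/δ))` if `t < δ`, `= 0` otherwise (`admissibleCutoff`).
Equivalently the plaquette *action* is `tₚ/(1 - tₚ/δ)` for `tₚ < δ` and `+∞` otherwise, so the
functional integral is restricted to the **admissible** configurations `{U | ∀ p, tₚ(U) < δ}`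
(`admissibleSet`), on which the weight is `exp(-β · admissibleAction)`
(`admissiblePlaquetteWeight_eq_exp_of_mem`).

## Sources and dictionary

* M. Lüscher, Nucl. Phys. B 549 (1999) 295, §2.1, eqs. (2.5)–(2.9) [Luscher1999AbelianChiral]:
  the abelian original — plaquette action `F²/(1 - F²/ε²)` if `|F| < ε`, `∞` otherwise, and the
  name "admissible" for fields with `|F_{μν}(x)| < ε` (eq. (2.9)); the Boltzmann factor is a smooth
  function of the link variables vanishing outside the admissible set.
* H. Fukaya et al. (JLQCD), Phys. Rev. D 74 (2006) 094505, eq. (2.2) [FukayaEtAl2006]: the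
  non-abelian TRACE form used here, `S = β' ∑ₚ sₚ/(1 - sₚ/ε)` if `sₚ < ε`, `∞` otherwise, with
  `sₚ = 1 - Re tr U_p/3`; `1/ε = 0` is the Wilson action. Dictionary: `sₚ = tₚ/N`, so their
  `(β', ε)` is our `(β, δ) = (β'/N, N ε)`.
* P. Hernández, K. Jansen, M. Lüscher, Nucl. Phys. B 552 (1999) 363, eqs. (2.15)–(2.16), §2.5
  [HernandezJansenLuscher1999]: the NORM form of admissibility, `‖1 - U(p)‖` bounded by `ε` for
  all plaquettes (operator norm in colour space), under which `A†A ≥ 1 - 30ε`, so Neuberger's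
  operator is local with uniform constants when `ε < 1/30`; recorded here in the strict (open)
  form `‖1 - ρ(U_p)‖ < ε` (`normAdmissibleSet`). For unitary `U`, `‖1 - U‖² ≤ 2 Re tr(1 - U)`, so
  `admissibleSet ρ δ ⊆ normAdmissibleSet ρ √(2δ)`; the cut `δ = 1/1800` corresponds to `ε = 1/30`
  (the comparison is proved in the companion proofs file).

## Contents

Definitions `admissibleCutoff`, `traceDefect`, `plaquetteDefect`, `admissibleSet` (trace form),
`normAdmissibleSet` (HJL norm form), `admissiblePlaquetteWeight`, `admissibleAction`,
`admissibleWeight` (un-normalised measure), `admissiblePartitionFunction` `Z`,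
`admissibleMeasure = Z⁻¹ • admissibleWeight`, `admissibleExpectation`, with the elementary API
proved here: `0 ≤ w ≤ 1` (`β ≥ 0`; `tₚ ≥ 0` for continuous `ρ` on compact `G`), `w > 0` exactly on
the admissible set, `w = exp(-β S_δ)` there, gauge invariance, `w(1) = 1`, `Z ≤ 1` for `β ≥ 0`.
The companion file `AdmissiblePlaquetteWeightProofs` proves measurability (product σ-algebra,
no countability assumption on `G`), continuity on the admissible set, openness and positive Haar
measure of the admissible set, `0 < Z`, that `admissibleMeasure` is a probability measure for
`β ≥ 0 < δ`, and the comparison `‖1 - U‖² ≤ 2 Re tr(1 - U)` with HJL's norm form. (For `β < 0`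
the density is not integrable at the cut; not formalised.)

## Not here

* Reflection positivity. For reflections in lattice hyperplanes THROUGH sites the
  Osterwalder–Seiler factorisation (Ann. Phys. 110 (1978) 440, §2) applies to any non-negative
  single-plaquette weight, this one included; not formalised. For reflections BETWEEN lattice
  planes (a positive transfer matrix) positivity FAILS for every single-plaquette weight vanishing
  on an open subset of the group, in particular for this one (M. Creutz, Phys. Rev. D 70 (2004)
  091501 [Creutz2004]).
* Gauge invariance of the normalised measure as a push-forward identity (cf. the named fact
  `wilsonMeasure_map_gaugeTransform` of Wave 0); only invariance of the density is proved.
-/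

open MeasureTheory Filter Complex
open Literature.RepresentationTheory.CompactGroups
open scoped Topology ENNReal

namespace Literature.MathematicalPhysics.QuantumFieldTheory

noncomputable section

/-! ## The cut-off Boltzmann factor of a single plaquette -/

section Cutoff

/-- Lüscher's cut-off Boltzmann factor of one plaquette, as a function of the plaquette defect
`t = Re tr(1 - U_p)`: `w_{β,δ}(t) = exp(-β t/(1 - t/δ))` if `t < δ` and `0` otherwise, i.e.
`exp(-β · L(t))` for the bounded plaquette action `L(t) = t/(1 - t/δ)` (`t < δ`), `L = ∞`
(`t ≥ δ`) (Lüscher 1999, eq. (2.6), abelian form `F²/(1 - F²/ε²)`; JLQCD 2006, eq. (2.2), trace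
form with `t/N` and `ε = δ/N`). Only `δ > 0` is meaningful. [cite: Luscher1999AbelianChiral, §2.1 eq. (2.6)] -/
def admissibleCutoff (β δ t : ℝ) : ℝ :=
  if t < δ then Real.exp (-(β * t / (1 - t / δ))) else 0

variable {β δ t : ℝ}

/-- Below the cut the factor is the exponential of the bounded plaquette action. [folklore] -/
theorem admissibleCutoff_of_lt (h : t < δ) :
    admissibleCutoff β δ t = Real.exp (-(β * t / (1 - t / δ))) :=
  if_pos h

/-- At and above the cut the factor vanishes. [folklore] -/
theorem admissibleCutoff_of_le (h : δ ≤ t) : admissibleCutoff β δ t = 0 :=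
  if_neg (not_lt.2 h)

/-- The same function with `1 - t/δ` written as `1 - δ⁻¹ t` (the form `1 - 1800 t` for
`δ = 1/1800` used by route OverlapPositivityTransfer). [folklore] -/
theorem admissibleCutoff_eq_ite_inv_mul (β δ t : ℝ) :
    admissibleCutoff β δ t = if t < δ then Real.exp (-(β * t / (1 - δ⁻¹ * t))) else 0 := by
  rw [admissibleCutoff, div_eq_inv_mul t δ]

/-- The cut-off factor is non-negative. [folklore] -/
theorem admissibleCutoff_nonneg (β δ t : ℝ) : 0 ≤ admissibleCutoff β δ t := by
  unfold admissibleCutoff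
  split_ifs
  · exact (Real.exp_pos _).le
  · exact le_rfl

/-- The cut-off factor is positive exactly below the cut. [folklore] -/
theorem admissibleCutoff_pos_iff : 0 < admissibleCutoff β δ t ↔ t < δ := by
  unfold admissibleCutoff
  split_ifs with h
  · exact ⟨fun _ => h, fun _ => Real.exp_pos _⟩
  · exact ⟨fun h0 => (lt_irrefl _ h0).elim, fun h' => (h h').elim⟩

/-- At zero defect (the trivial plaquette) the factor is `1`. [folklore] -/
@[simp]
theorem admissibleCutoff_zero (β : ℝ) (hδ : 0 < δ) : admissibleCutoff β δ 0 = 1 := by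
  rw [admissibleCutoff_of_lt hδ, mul_zero, zero_div, neg_zero, Real.exp_zero]

/-- For `β ≥ 0` and non-negative defect the factor is at most `1` (the exponent is `≤ 0`;
`0 ≤ t < δ` forces `0 < 1 - t/δ`). [folklore] -/
theorem admissibleCutoff_le_one (hβ : 0 ≤ β) (ht : 0 ≤ t) : admissibleCutoff β δ t ≤ 1 := by
  unfold admissibleCutoff
  split_ifs with h
  · have hδ : 0 < δ := ht.trans_lt h
    have h1 : 0 < 1 - t / δ := sub_pos.2 ((div_lt_one hδ).2 h)
    rw [Real.exp_le_one_iff, neg_nonpos]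
    exact div_nonneg (mul_nonneg hβ ht) h1.le
  · exact zero_le_one

end Cutoff

/-! ## The plaquette defect `t = Re tr(1 - ρ(U_p))` -/

section Defect

variable {N : ℕ} {G : Type*} [Group G] (ρ : G →* Matrix (Fin N) (Fin N) ℂ)

/-- The defect `t(g) = N - Re tr ρ(g) = Re tr(1 - ρ(g))` of a group element in the
`N`-dimensional matrix representation `ρ` — the single-plaquette Wilson action
(`wilsonAction = ∑ₚ t(U_p)`) and the argument of the admissibility cut-off. [folklore] -/
def traceDefect (g : G) : ℝ :=
  (N : ℝ) - (ρ g).trace.re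

/-- `t(g) = Re tr(1 - ρ(g))`. [folklore] -/
theorem traceDefect_eq_re_trace_one_sub (g : G) :
    traceDefect ρ g = ((1 : Matrix (Fin N) (Fin N) ℂ) - ρ g).trace.re := by
  simp [traceDefect, Matrix.trace_sub, Matrix.trace_one]

/-- The defect of the identity vanishes. [folklore] -/
@[simp]
theorem traceDefect_one : traceDefect ρ 1 = 0 := by
  simp [traceDefect, Matrix.trace_one]

/-- The defect is a class function. [folklore] -/
theorem traceDefect_conj (g h : G) : traceDefect ρ (h * g * h⁻¹) = traceDefect ρ g := by
  rw [traceDefect, traceDefect, CompactGroup.trace_conj_eq]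

variable [TopologicalSpace G] [IsTopologicalGroup G] [CompactSpace G]

/-- `0 ≤ t(g)`: for a continuous representation of a compact group `Re tr ρ(g) ≤ N` (the
representation is unitarisable, `CompactGroup.abs_re_trace_le_card`). [folklore] -/
theorem traceDefect_nonneg (hρ : Continuous ρ) (g : G) : 0 ≤ traceDefect ρ g := by
  have h := (abs_le.1 (CompactGroup.abs_re_trace_le_card ρ hρ g)).2
  simp only [Fintype.card_fin] at h
  unfold traceDefect
  linarith

end Defect

section Plaquette

variable {d L N : ℕ} {G : Type*} [Group G] (ρ : G →* Matrix (Fin N) (Fin N) ℂ)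

/-- The plaquette defect `tₚ(U) = Re tr(1 - ρ(U_p)) = N - Re tr ρ(U_p)` of a configuration on
the torus (JLQCD 2006 eq. (2.2) uses `sₚ = tₚ/N = 1 - Re tr U_p/N`). [cite: FukayaEtAl2006, eq. (2.2)] -/
def plaquetteDefect (U : GaugeConfig d L G) (p : Plaquette d L) : ℝ :=
  traceDefect ρ (plaquetteHolonomy U p.1 p.2.1.1 p.2.1.2)

/-- The Wilson action of Wave 0 is the sum of the plaquette defects. [folklore] -/
theorem wilsonAction_eq_sum_plaquetteDefect [NeZero L] (U : GaugeConfig d L G) :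
    wilsonAction ρ U = ∑ p, plaquetteDefect ρ U p :=
  rfl

/-- The trivial configuration has zero defect on every plaquette. [folklore] -/
@[simp]
theorem plaquetteDefect_one (p : Plaquette d L) :
    plaquetteDefect ρ (1 : GaugeConfig d L G) p = 0 := by
  simp [plaquetteDefect, plaquetteHolonomy]

/-- Gauge invariance of the plaquette defect: the holonomy transforms by conjugation,
`(U^g)_p = g(x) U_p g(x)⁻¹`, and the defect is a class function. [folklore] -/
theorem plaquetteDefect_gaugeTransform (g : Site d L → G) (U : GaugeConfig d L G)
    (p : Plaquette d L) :
    plaquetteDefect ρ (gaugeTransform g U) p = plaquetteDefect ρ U p := by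
  obtain ⟨x, ⟨i, j⟩, _⟩ := p
  have hshift : (x.shift j).shift i = (x.shift i).shift j := by
    simp only [Site.shift, add_assoc, add_comm (Pi.single (M := fun _ => ZMod L) j 1)]
  have hhol : plaquetteHolonomy (gaugeTransform g U) x i j =
      g x * plaquetteHolonomy U x i j * (g x)⁻¹ := by
    simp only [plaquetteHolonomy, gaugeTransform, hshift, mul_inv_rev, inv_inv]
    group
  simp only [plaquetteDefect, hhol]
  exact traceDefect_conj ρ _ _

variable [TopologicalSpace G] [IsTopologicalGroup G] [CompactSpace G]

/-- `0 ≤ tₚ(U)` (continuous `ρ`, compact `G`). [folklore] -/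
theorem plaquetteDefect_nonneg (hρ : Continuous ρ) (U : GaugeConfig d L G) (p : Plaquette d L) :
    0 ≤ plaquetteDefect ρ U p :=
  traceDefect_nonneg ρ hρ _

end Plaquette

/-! ## Admissible configurations: trace form and norm form -/

section Admissible

variable {d L N : ℕ} {G : Type*} [Group G] (ρ : G →* Matrix (Fin N) (Fin N) ℂ)

/-- The **admissible configurations** (trace form) with cut `δ`: `tₚ(U) < δ` for every
plaquette — the effective support of the functional integral with Lüscher's plaquette action
(Lüscher 1999 eq. (2.9), there `|F_{μν}(x)| < ε`; JLQCD 2006 eq. (2.2), `1 - Re tr U_p/3 < ε`). [cite: Luscher1999AbelianChiral, §2.1 eq. (2.9)] -/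
def admissibleSet (δ : ℝ) : Set (GaugeConfig d L G) :=
  {U | ∀ p : Plaquette d L, plaquetteDefect ρ U p < δ}

variable {ρ} in
/-- Membership in the admissible set. [folklore] -/
theorem mem_admissibleSet_iff {δ : ℝ} {U : GaugeConfig d L G} :
    U ∈ admissibleSet ρ δ ↔ ∀ p : Plaquette d L, plaquetteDefect ρ U p < δ :=
  Iff.rfl

/-- The trivial configuration `U ≡ 1` is admissible for every positive cut. [folklore] -/
theorem one_mem_admissibleSet {δ : ℝ} (hδ : 0 < δ) :
    (1 : GaugeConfig d L G) ∈ admissibleSet ρ δ := fun p => by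
  simpa using hδ

/-- The admissible set is gauge invariant. [folklore] -/
theorem gaugeTransform_mem_admissibleSet_iff {δ : ℝ} (g : Site d L → G) (U : GaugeConfig d L G) :
    gaugeTransform g U ∈ admissibleSet ρ δ ↔ U ∈ admissibleSet ρ δ := by
  simp only [mem_admissibleSet_iff, plaquetteDefect_gaugeTransform]

open scoped Matrix.Norms.L2Operator in
/-- The **admissible configurations in norm form** (after Hernández–Jansen–Lüscher 1999,
eq. (2.15)): `‖1 - ρ(U_p)‖ < ε` for every plaquette, the norm being the operator (spectral) norm
on `ℂ^N` ("the matrix norm in colour space"; Mathlib's `Matrix.instL2OpNormedAddCommGroup`, scope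
`Matrix.Norms.L2Operator`). Under HJL's hypothesis (2.15) — the bound of `‖1 - U(p)‖` by `ε` for
all plaquettes, printed with `≤ ε` in the arXiv version hep-lat/9808010 — one has `A†A ≥ 1 - 30ε`
(eq. (2.16)), whence uniform exponential locality of Neuberger's operator for `ε < 1/30` (§2.5).
The STRICT (open) form is used here, matching Lüscher's `|F_{μν}(x)| < ε` (1999, eq. (2.9)) and
the trace form `admissibleSet`; since HJL's conclusions are applied with `ε < 1/30`, the two
forms are interchangeable (`{< ε} ⊆ {≤ ε} ⊆ {< ε'}` for `ε < ε'`). [cite: HernandezJansenLuscher1999, eq. (2.15)] -/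
def normAdmissibleSet (ε : ℝ) : Set (GaugeConfig d L G) :=
  {U | ∀ p : Plaquette d L,
    ‖(1 : Matrix (Fin N) (Fin N) ℂ) - ρ (plaquetteHolonomy U p.1 p.2.1.1 p.2.1.2)‖ < ε}

open scoped Matrix.Norms.L2Operator in
variable {ρ} in
/-- Membership in the norm-admissible set. [folklore] -/
theorem mem_normAdmissibleSet_iff {ε : ℝ} {U : GaugeConfig d L G} :
    U ∈ normAdmissibleSet ρ ε ↔ ∀ p : Plaquette d L,
      ‖(1 : Matrix (Fin N) (Fin N) ℂ) - ρ (plaquetteHolonomy U p.1 p.2.1.1 p.2.1.2)‖ < ε :=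
  Iff.rfl

end Admissible

/-! ## The weight -/

section Weight

variable {d L N : ℕ} [NeZero L] {G : Type*} [Group G] (ρ : G →* Matrix (Fin N) (Fin N) ℂ)

/-- **Lüscher's admissibility-constrained plaquette weight** on configurations of the torus
`(ℤ/Lℤ)^d`: `w(U) = ∏ₚ w_{β,δ}(tₚ(U))` with `tₚ = Re tr(1 - ρ(U_p))` and the cut-off factor
`admissibleCutoff` — equivalently `exp(-β ∑ₚ tₚ/(1 - tₚ/δ))` on admissible configurations and
`0` elsewhere (`admissiblePlaquetteWeight_eq_exp_of_mem`, `..._eq_zero_of_not_mem`). Trace form of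
JLQCD 2006 eq. (2.2) (`(β, δ) = (β'/N, Nε)` in their notation), after Lüscher 1999 eq. (2.5)–(2.6). [cite: FukayaEtAl2006, eq. (2.2)] -/
def admissiblePlaquetteWeight (β δ : ℝ) (U : GaugeConfig d L G) : ℝ :=
  ∏ p : Plaquette d L, admissibleCutoff β δ (plaquetteDefect ρ U p)

/-- The finite part of Lüscher's modified plaquette action, `S_δ(U) = ∑ₚ tₚ/(1 - tₚ/δ)` (meaningful
on the admissible set, where every denominator is positive; Lüscher 1999 eq. (2.5)–(2.6), JLQCD
2006 eq. (2.2)). [cite: Luscher1999AbelianChiral, §2.1 eq. (2.5)–(2.6)] -/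
def admissibleAction (δ : ℝ) (U : GaugeConfig d L G) : ℝ :=
  ∑ p : Plaquette d L, plaquetteDefect ρ U p / (1 - plaquetteDefect ρ U p / δ)

variable {β δ : ℝ}

/-- The weight written out with the route's cut-off convention `1 - δ⁻¹ t`. [folklore] -/
theorem admissiblePlaquetteWeight_eq_prod_ite (β δ : ℝ) (U : GaugeConfig d L G) :
    admissiblePlaquetteWeight ρ β δ U = ∏ p : Plaquette d L,
      (fun t : ℝ => if t < δ then Real.exp (-(β * t / (1 - δ⁻¹ * t))) else 0)
        ((N : ℝ) - (ρ (plaquetteHolonomy U p.1 p.2.1.1 p.2.1.2)).trace.re) :=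
  Finset.prod_congr rfl fun p _ => by rw [admissibleCutoff_eq_ite_inv_mul]; rfl

/-- The weight is non-negative. [folklore] -/
theorem admissiblePlaquetteWeight_nonneg (β δ : ℝ) (U : GaugeConfig d L G) :
    0 ≤ admissiblePlaquetteWeight ρ β δ U :=
  Finset.prod_nonneg fun _ _ => admissibleCutoff_nonneg β δ _

/-- On admissible configurations the weight is `exp(-β S_δ(U))`. [folklore] -/
theorem admissiblePlaquetteWeight_eq_exp_of_mem {U : GaugeConfig d L G} (hU : U ∈ admissibleSet ρ δ) :
    admissiblePlaquetteWeight ρ β δ U = Real.exp (-(β * admissibleAction ρ δ U)) := by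
  rw [admissibleAction, Finset.mul_sum, ← Finset.sum_neg_distrib, Real.exp_sum]
  refine Finset.prod_congr rfl fun p _ => ?_
  rw [admissibleCutoff_of_lt (hU p), mul_div_assoc]

/-- Off the admissible set the weight vanishes. [folklore] -/
theorem admissiblePlaquetteWeight_eq_zero_of_not_mem {U : GaugeConfig d L G}
    (hU : U ∉ admissibleSet ρ δ) : admissiblePlaquetteWeight ρ β δ U = 0 := by
  simp only [mem_admissibleSet_iff, not_forall, not_lt] at hU
  obtain ⟨p, hp⟩ := hU
  exact Finset.prod_eq_zero (Finset.mem_univ p) (admissibleCutoff_of_le hp)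

/-- The weight is positive exactly on the admissible set. [folklore] -/
theorem admissiblePlaquetteWeight_pos_iff {U : GaugeConfig d L G} :
    0 < admissiblePlaquetteWeight ρ β δ U ↔ U ∈ admissibleSet ρ δ := by
  refine ⟨fun h => ?_, fun h => Finset.prod_pos fun p _ => admissibleCutoff_pos_iff.2 (h p)⟩
  by_contra hU
  rw [admissiblePlaquetteWeight_eq_zero_of_not_mem ρ hU] at h
  exact lt_irrefl _ h

/-- The weight of the trivial configuration is `1` (`δ > 0`). [folklore] -/
@[simp]
theorem admissiblePlaquetteWeight_one (β : ℝ) (hδ : 0 < δ) :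
    admissiblePlaquetteWeight ρ β δ (1 : GaugeConfig d L G) = 1 := by
  simp [admissiblePlaquetteWeight, hδ]

/-- **Gauge invariance** of the weight (each factor is a class function of the plaquette
holonomy, which transforms by conjugation). [folklore] -/
theorem admissiblePlaquetteWeight_gaugeTransform (β δ : ℝ) (g : Site d L → G) (U : GaugeConfig d L G) :
    admissiblePlaquetteWeight ρ β δ (gaugeTransform g U) = admissiblePlaquetteWeight ρ β δ U := by
  simp only [admissiblePlaquetteWeight, plaquetteDefect_gaugeTransform]

/-- The weight is a gauge-invariant observable. [folklore] -/
theorem isGaugeInvariant_admissiblePlaquetteWeight (β δ : ℝ) :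
    IsGaugeInvariant (admissiblePlaquetteWeight (d := d) (L := L) ρ β δ) :=
  fun g U => admissiblePlaquetteWeight_gaugeTransform ρ β δ g U

variable [TopologicalSpace G] [IsTopologicalGroup G] [CompactSpace G]

/-- `w(U) ≤ 1` for `β ≥ 0` (continuous `ρ`, compact `G`, so that every `tₚ ≥ 0`). [folklore] -/
theorem admissiblePlaquetteWeight_le_one (hρ : Continuous ρ) (hβ : 0 ≤ β) (δ : ℝ)
    (U : GaugeConfig d L G) : admissiblePlaquetteWeight ρ β δ U ≤ 1 :=
  Finset.prod_le_one (fun _ _ => admissibleCutoff_nonneg β δ _)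
    fun p _ => admissibleCutoff_le_one hβ (plaquetteDefect_nonneg ρ hρ U p)

end Weight

/-! ## The un-normalised measure, the partition function and the normalised measure -/

section Measure

variable {d L N : ℕ} [NeZero L] {G : Type*} [Group G] [TopologicalSpace G] [IsTopologicalGroup G]
  [CompactSpace G] [MeasurableSpace G] [BorelSpace G] (ρ : G →* Matrix (Fin N) (Fin N) ℂ)

/-- The un-normalised admissible weight `w(U) ∏ₑ dU_e` as a measure on configurations: product
Haar measure with density `admissiblePlaquetteWeight` (cf. `wilsonWeight`). [folklore] -/
def admissibleWeight (β δ : ℝ) : Measure (GaugeConfig d L G) :=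
  (Measure.pi fun _ : Edge d L => haarProbability G).withDensity
    fun U => ENNReal.ofReal (admissiblePlaquetteWeight ρ β δ U)

/-- The partition function `Z = ∫ w(U) ∏ₑ dU_e` of the admissibility-constrained action, as an
extended non-negative real (cf. `partitionFunction`). [folklore] -/
def admissiblePartitionFunction (β δ : ℝ) : ℝ≥0∞ :=
  admissibleWeight (d := d) (L := L) ρ β δ Set.univ

/-- The **admissibility-constrained lattice gauge measure** `Z⁻¹ w(U) ∏ₑ dU_e` on configurations
of the torus (JLQCD 2006 §2; a probability measure for continuous `ρ`, `β ≥ 0` and `δ > 0`,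
`isProbabilityMeasure_admissibleMeasure`; junk otherwise, cf. `wilsonMeasure`). [cite: FukayaEtAl2006, §2 eq. (2.2)] -/
def admissibleMeasure (β δ : ℝ) : Measure (GaugeConfig d L G) :=
  (admissiblePartitionFunction (d := d) (L := L) ρ β δ)⁻¹ • admissibleWeight ρ β δ

/-- Expectation `⟨F⟩ = ∫ F dμ` in the admissibility-constrained theory (Bochner integral, junk
`0` for non-integrable `F`; cf. `wilsonExpectation`). [folklore] -/
def admissibleExpectation {V : Type*} [NormedAddCommGroup V] [NormedSpace ℝ V] (β δ : ℝ)
    (F : GaugeConfig d L G → V) : V :=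
  ∫ U, F U ∂(admissibleMeasure ρ β δ)

variable {β δ : ℝ}

/-- `Z` as a lower Lebesgue integral of the weight against product Haar measure. [folklore] -/
theorem admissiblePartitionFunction_eq_lintegral (β δ : ℝ) :
    admissiblePartitionFunction (d := d) (L := L) ρ β δ =
      ∫⁻ U, ENNReal.ofReal (admissiblePlaquetteWeight ρ β δ U)
        ∂(Measure.pi fun _ : Edge d L => haarProbability G) := by
  rw [admissiblePartitionFunction, admissibleWeight, withDensity_apply _ MeasurableSet.univ,
    Measure.restrict_univ]

/-- `Z ≤ 1` for `β ≥ 0` (the weight is at most `1` and product Haar is a probability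
measure). [folklore] -/
theorem admissiblePartitionFunction_le_one (hρ : Continuous ρ) (hβ : 0 ≤ β) (δ : ℝ) :
    admissiblePartitionFunction (d := d) (L := L) ρ β δ ≤ 1 := by
  rw [admissiblePartitionFunction_eq_lintegral]
  calc ∫⁻ U, ENNReal.ofReal (admissiblePlaquetteWeight ρ β δ U)
        ∂(Measure.pi fun _ : Edge d L => haarProbability G)
      ≤ ∫⁻ _, 1 ∂(Measure.pi fun _ : Edge d L => haarProbability G) :=
        lintegral_mono fun U =>
          ENNReal.ofReal_le_one.2 (admissiblePlaquetteWeight_le_one ρ hρ hβ δ U)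
    _ = 1 := by rw [lintegral_const, one_mul, measure_univ]

/-- `Z < ∞` for `β ≥ 0`. [folklore] -/
theorem admissiblePartitionFunction_ne_top (hρ : Continuous ρ) (hβ : 0 ≤ β) (δ : ℝ) :
    admissiblePartitionFunction (d := d) (L := L) ρ β δ ≠ ⊤ :=
  ne_top_of_le_ne_top ENNReal.one_ne_top (admissiblePartitionFunction_le_one ρ hρ hβ δ)

end Measure

end

end Literature.MathematicalPhysics.QuantumFieldTheory
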